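import Mathlib
import HarnessLib
import Summits.NavierStokesRegularity.NavierStokesRegularity.Theorems.PoloidalWindowDoorPoloidalWindowRigiditySparseEnergyTimeMeans
import Summits.NavierStokesRegularity.NavierStokesRegularity.Theorems.PoloidalWindowDoorPoloidalWindowRigiditySparseEnergyPlaneMeansUniform
import Summits.NavierStokesRegularity.NavierStokesRegularity.Theorems.PoloidalWindowDoorPoloidalWindowRigidityConstantShearSlice

/-!
# Route `PoloidalWindowDoor`, crux `PoloidalWindowRigidity` (stmt-19708), line `sparse_energy`, rung R2 —
# SPARSE ENERGY ⇒ THE (TH) PRESSURE DATUM VANISHES: `A ≡ 0` (the (TH) system is source-free)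

Seat ns-poloidal-K2-p2 g8 (interim LEAD-of-record on 19708; file `--supports`).  Rung R2 of the line `sparse_energy`
(`Cruxes/PoloidalWindowRigidity/Lines/sparse_energy.md`, «First rungs»), the (TH)-column consequence of the bounded scale-invariant
energy (S1) through the plane means (S3): for a profile `v` of the route's Type-I class (rate `C`, continuous, Oseen-mild,
divergence-free) whose scale-invariant energy is bounded (`∫_{B_R(a)}|v(t₀)|² ≤ K R`), and a (TH) datum `(μ, A)` analytic on a
box `(t₁,t₂) × (z₁,z₂)` (`t₂ ≤ 0`) whose scalar law E holds on the WHOLE horizontal slab `(t₁,t₂) × {z₁ < x₂ < z₂}` (as delivered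
from the window by `…TwistingTHSlab.eLaw_on_of_germ`), the pressure datum vanishes identically:

  `pressureDatum_eq_zero : ∀ (t,ζ) ∈ box, A(t,ζ) = 0`.

Proof (CENSUS-19708-K2p2-g8 §5, made exact).  Fix `ζ` and `t₁ < t' ≤ t < t₂`.  At each time `s ∈ [t',t]` the plane mean at scale `R`
of E over `{x₂ = ζ}` gives (`…SparseEnergyPlaneLaw.abs_pressureDatum_sub_le`)
`|A(s,ζ) − (1−μ)⟨∂ₜv₂⟩| ≤ Θ(δ,R)` with `⟨|v(s)|²⟩ ≤ δ²` uniformly in `s ≤ t` for `R ≥ R₀(δ)` (`planeMeansVanish_uniform`); and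
`∫_{t'}^{t} (1−μ)⟨∂ₜv₂⟩ ds = [(1−μ)⟨v₂⟩]_{t'}^{t} + ∫ ∂ₜμ⟨v₂⟩` (`hasDerivAt_hmean_two`, integration by parts) is `O(δ)` because
`|⟨v₂⟩| ≤ δ`.  Hence `|∫_{t'}^{t} A(s,ζ) ds| ≤ δ·P + R⁻¹·Q` for constants `P, Q` of the data — so the integral vanishes for all
`t' ≤ t`, and `A(·,ζ)`, being continuous, is zero (fundamental theorem of calculus).

Consequence for the engines / the kernel port: on K-sparse profiles every `a_j` letter of KERNEL-CERT-FORMAT-g8 vanishes and the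
rows `(k,0,0)` of the jet hierarchy become LAWS (CENSUS §4 (I)).  WHAT THIS IS NOT: not a claim about Navier–Stokes regularity and
not the crux — a theorem INSIDE the line `sparse_energy` (its class-level input S1 `stub_scaledEnergy` is still open); bears_on
LADDER-NS N0 via crux 19708 / item 20428.
-/

noncomputable section

-- the summit and its single sub-problem share the name (CONVENTIONS §1), as in every Theorems file
set_option linter.dupNamespace false

namespace Summit.NavierStokesRegularity.NavierStokesRegularity.Theorems.PoloidalWindowDoorPoloidalWindowRigiditySparseEnergySourceFree

open MeasureTheory Set Function Filter Topology Metric intervalIntegral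
open scoped RealInnerProductSpace InnerProductSpace Laplacian ENNReal
open Literature.Analysis Literature.Analysis.FluidPDE
open Summit.NavierStokesRegularity.NavierStokesRegularity.Theorems.PoloidalWindowDoorPoloidalWindowRigidityHorizontalMean
open Summit.NavierStokesRegularity.NavierStokesRegularity.Theorems.PoloidalWindowDoorPoloidalWindowRigiditySparseEnergyPlaneLaw
open Summit.NavierStokesRegularity.NavierStokesRegularity.Theorems.PoloidalWindowDoorPoloidalWindowRigiditySparseEnergyTimeMeans
open Summit.NavierStokesRegularity.NavierStokesRegularity.Theorems.PoloidalWindowDoorPoloidalWindowRigiditySparseEnergyPlaneMeansUniform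
open Summit.NavierStokesRegularity.NavierStokesRegularity.Theorems.PoloidalWindowDoorPoloidalWindowRigidityClassRate
open Summit.NavierStokesRegularity.NavierStokesRegularity.Theorems.PoloidalWindowDoorPoloidalWindowRigidityClebsch
open Summit.NavierStokesRegularity.NavierStokesRegularity.Theorems.PoloidalWindowDoorPoloidalWindowRigidityConstantShearSlice (div_coord)

variable {C : ℝ} {v : ℝ → EuclideanSpace ℝ (Fin 3) → EuclideanSpace ℝ (Fin 3)}

/-- A real number whose absolute value is below every positive number is zero. [folklore] -/
theorem eq_zero_of_abs_le_all {x : ℝ} (h : ∀ η : ℝ, 0 < η → |x| ≤ η) : x = 0 := by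
  by_contra hx
  have hpos := abs_pos.2 hx
  have := h (|x| / 2) (half_pos hpos)
  linarith

/-- **The time integrals of the pressure datum vanish** (the analytic core of `pressureDatum_eq_zero`): for `ζ ∈ (z₁,z₂)` and
`t₁ < t' ≤ t < t₂`, `∫_{t'}^{t} A(s,ζ) ds = 0`. [folklore] -/
theorem integral_pressureDatum_eq_zero (hrate : HasTypeITimeDecay C v)
    (hcont : ContinuousOn (uncurry v) (Iio (0 : ℝ) ×ˢ univ))
    (hmild : ∀ s t : ℝ, s < t → t < 0 → ∀ x,
      v t x = UnboundedOperators.heatExtension (v s) (t - s) x - oseenDuhamel 1 s v v t x)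
    (hdiv : ∀ t < 0, VectorCalculus.IsDivFree (v t))
    {K : ℝ} (hK0 : 0 ≤ K)
    (hK : ∀ t₀ : ℝ, t₀ < 0 → ∀ (a : EuclideanSpace ℝ (Fin 3)) (R : ℝ), 0 < R →
      (∫⁻ x in Metric.ball a R, ENNReal.ofReal (‖v t₀ x‖ ^ 2)) ≤ ENNReal.ofReal (K * R))
    {μ A : ℝ → ℝ → ℝ} {t₁ t₂ z₁ z₂ : ℝ} (ht₂ : t₂ ≤ 0)
    (hμ : ∀ q ∈ Ioo t₁ t₂ ×ˢ Ioo z₁ z₂, AnalyticAt ℝ (uncurry μ) q)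
    (hA : ∀ q ∈ Ioo t₁ t₂ ×ˢ Ioo z₁ z₂, AnalyticAt ℝ (uncurry A) q)
    (hE : ∀ p ∈ Ioo t₁ t₂ ×ˢ {x : EuclideanSpace ℝ (Fin 3) | z₁ < x 2 ∧ x 2 < z₂},
      (1 - μ p.1 (p.2 2)) *
          (deriv (fun s => v s p.2 2) p.1 + fderiv ℝ (fun y => v p.1 y 2) p.2 (v p.1 p.2) - Δ (fun y => v p.1 y 2) p.2) =
        A p.1 (p.2 2) + (deriv (fun s => μ s (p.2 2)) p.1 - deriv (deriv (μ p.1)) (p.2 2)) * v p.1 p.2 2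
          + deriv (μ p.1) (p.2 2) / 2 * v p.1 p.2 2 ^ 2 - 2 * deriv (μ p.1) (p.2 2) * fderiv ℝ (v p.1) p.2 (EuclideanSpace.single 2 1) 2)
    {ζ : ℝ} (hζ : ζ ∈ Ioo z₁ z₂) {t' t : ℝ} (ht₁' : t₁ < t') (ht't : t' ≤ t) (htt₂ : t < t₂) :
    ∫ s in t'..t, A s ζ = 0 := by
  have hsm := isSmoothSpaceTimeOn_of_class hrate hcont hmild
  obtain ⟨φ⟩ : Nonempty (ContDiffBump (0 : EuclideanSpace ℝ (Fin 2))) := ⟨⟨1, 2, one_pos, one_lt_two⟩⟩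
  obtain ⟨hf0c, hftc, hfzc, hfzzc⟩ := continuousOn_boxCoeffs hμ hζ
  obtain ⟨hfac, -, -, -⟩ := continuousOn_boxCoeffs hA hζ
  have ht0 : t < 0 := lt_of_lt_of_le htt₂ ht₂
  have hIcc : Icc t' t ⊆ Ioo t₁ t₂ := fun s hs => ⟨lt_of_lt_of_le ht₁' hs.1, lt_of_le_of_lt hs.2 htt₂⟩
  have hIcc0 : Icc t' t ⊆ Iio (0 : ℝ) := fun s hs => lt_of_le_of_lt hs.2 ht0
  -- bounds for the coefficients on `[t', t]`
  obtain ⟨B1, hB1⟩ := isCompact_Icc.exists_bound_of_continuousOn ((continuousOn_const.sub hf0c).mono hIcc :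
    ContinuousOn (fun s => 1 - μ s ζ) (Icc t' t))
  obtain ⟨B2, hB2⟩ := isCompact_Icc.exists_bound_of_continuousOn (hftc.mono hIcc)
  obtain ⟨B3, hB3⟩ := isCompact_Icc.exists_bound_of_continuousOn (hfzc.mono hIcc)
  obtain ⟨B4, hB4⟩ := isCompact_Icc.exists_bound_of_continuousOn (hfzzc.mono hIcc)
  obtain ⟨Bμ, hBμ⟩ : ∃ B : ℝ, B = max (max B1 B2) (max B3 B4) := ⟨_, rfl⟩
  have ht'mem : t' ∈ Icc t' t := ⟨le_rfl, ht't⟩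
  have hle1 : B1 ≤ Bμ := by rw [hBμ]; exact le_trans (le_max_left _ _) (le_max_left _ _)
  have hle2 : B2 ≤ Bμ := by rw [hBμ]; exact le_trans (le_max_right _ _) (le_max_left _ _)
  have hle3 : B3 ≤ Bμ := by rw [hBμ]; exact le_trans (le_max_left _ _) (le_max_right _ _)
  have hle4 : B4 ≤ Bμ := by rw [hBμ]; exact le_trans (le_max_right _ _) (le_max_right _ _)
  have hBμ0 : 0 ≤ Bμ := le_trans (le_trans (norm_nonneg _) (hB1 t' ht'mem)) hle1
  have hb1 : ∀ s ∈ Icc t' t, |1 - μ s ζ| ≤ Bμ := fun s hs =>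
    le_trans (by simpa [Real.norm_eq_abs] using hB1 s hs) hle1
  have hb2 : ∀ s ∈ Icc t' t, |deriv (fun σ => μ σ ζ) s| ≤ Bμ := fun s hs =>
    le_trans (by simpa [Real.norm_eq_abs] using hB2 s hs) hle2
  have hb3 : ∀ s ∈ Icc t' t, |deriv (μ s) ζ| ≤ Bμ := fun s hs =>
    le_trans (by simpa [Real.norm_eq_abs] using hB3 s hs) hle3
  have hb4 : ∀ s ∈ Icc t' t, |deriv (deriv (μ s)) ζ| ≤ Bμ := fun s hs =>
    le_trans (by simpa [Real.norm_eq_abs] using hB4 s hs) hle4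
  -- slice constants of the class at times `≤ t`
  have ht0' : 0 < -t := neg_pos.2 ht0
  have hC0 : 0 ≤ C := by
    have h := hrate t ht0 0
    have hs : 0 < Real.sqrt (-t) := Real.sqrt_pos.2 ht0'
    by_contra hC
    have : C / Real.sqrt (-t) < 0 := div_neg_of_neg_of_pos (lt_of_not_ge hC) hs
    linarith [norm_nonneg (v t 0)]
  obtain ⟨C₁, hC₁⟩ := exists_fderiv_rate_of_class hrate hcont hmild
  have hC₁0 : 0 ≤ C₁ := by
    have h := hC₁ t ht0 0
    by_contra hC
    have : C₁ / (-t) < 0 := div_neg_of_neg_of_pos (lt_of_not_ge hC) ht0'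
    linarith [norm_nonneg (fderiv ℝ (v t) 0)]
  obtain ⟨M₀, hM₀⟩ : ∃ M : ℝ, M = C / Real.sqrt (-t) := ⟨_, rfl⟩
  obtain ⟨M₁, hM₁⟩ : ∃ M : ℝ, M = C₁ / (-t) := ⟨_, rfl⟩
  have hM₀0 : 0 ≤ M₀ := by rw [hM₀]; positivity
  have hM₁0 : 0 ≤ M₁ := by rw [hM₁]; positivity
  have hvM : ∀ s ≤ t, ∀ x, ‖v s x‖ ≤ M₀ := by
    intro s hs x
    have hs0 : s < 0 := lt_of_le_of_lt hs ht0
    refine (hrate s hs0 x).trans ?_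
    rw [hM₀]
    exact div_le_div_of_nonneg_left hC0 (Real.sqrt_pos.2 ht0') (Real.sqrt_le_sqrt (by linarith))
  have hDvM : ∀ s ≤ t, ∀ x, ‖fderiv ℝ (v s) x‖ ≤ M₁ := by
    intro s hs x
    have hs0 : s < 0 := lt_of_le_of_lt hs ht0
    refine (hC₁ s hs0 x).trans ?_
    rw [hM₁]
    exact div_le_div_of_nonneg_left hC₁0 ht0' (by linarith)
  obtain ⟨Bφ, hBφ⟩ : ∃ B : ℝ, B = bumpDerivNorm φ 0 + bumpDerivNorm φ 1 := ⟨_, rfl⟩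
  have hBφ0 : 0 ≤ Bφ := by rw [hBφ]; exact add_nonneg (bumpDerivNorm_nonneg φ 0) (bumpDerivNorm_nonneg φ 1)
  -- the integral is below every positive number
  refine eq_zero_of_abs_le_all fun η hη => ?_
  obtain ⟨L, hL⟩ : ∃ L : ℝ, L = t - t' := ⟨_, rfl⟩
  have hL0 : 0 ≤ L := by rw [hL]; linarith
  obtain ⟨P, hP⟩ : ∃ P : ℝ, P = L * Bμ * (3 * M₁ + 7 / 2) + 2 * Bμ := ⟨_, rfl⟩
  obtain ⟨Q, hQ⟩ : ∃ Q : ℝ, Q = L * Bμ * (2 * M₁ * Bφ + 2 * M₀ * Bφ) := ⟨_, rfl⟩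
  have hP0 : 0 ≤ P := by rw [hP]; positivity
  have hQ0 : 0 ≤ Q := by rw [hQ]; positivity
  obtain ⟨δ, hδ⟩ : ∃ d : ℝ, d = min 1 (η / (2 * (P + 1))) := ⟨_, rfl⟩
  have hδ0 : 0 < δ := by rw [hδ]; exact lt_min one_pos (by positivity)
  have hδ1 : δ ≤ 1 := by rw [hδ]; exact min_le_left _ _
  have hδP : δ * P ≤ η / 2 := by
    have h1 : δ ≤ η / (2 * (P + 1)) := by rw [hδ]; exact min_le_right _ _
    have h2 : δ * P ≤ η / (2 * (P + 1)) * P := mul_le_mul_of_nonneg_right h1 hP0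
    have h3 : η / (2 * (P + 1)) * P ≤ η / 2 := by
      rw [div_mul_eq_mul_div, div_le_div_iff₀ (by positivity) (by positivity)]
      nlinarith only [hP0, hη]
    linarith only [h2, h3]
  obtain ⟨R₀, hR₀0, hR₀⟩ := planeMeansVanish_uniform hrate hcont hmild hK0 hK φ ht0 (ε := δ ^ 2) (by positivity)
  obtain ⟨R, hR⟩ : ∃ r : ℝ, r = max R₀ (max 1 (2 * (Q + 1) / η)) := ⟨_, rfl⟩
  have hRR₀ : R₀ ≤ R := by rw [hR]; exact le_max_left _ _
  have hR1 : 1 ≤ R := by rw [hR]; exact le_trans (le_max_left _ _) (le_max_right _ _)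
  have hRpos : 0 < R := lt_of_lt_of_le one_pos hR1
  have hRQ : R⁻¹ * Q ≤ η / 2 := by
    have h1 : 2 * (Q + 1) / η ≤ R := by rw [hR]; exact le_trans (le_max_right _ _) (le_max_right _ _)
    rw [inv_mul_le_iff₀ hRpos]
    have h2 : 2 * (Q + 1) ≤ R * η := by rwa [div_le_iff₀ hη] at h1
    nlinarith only [h2, hQ0, hη]
  -- the means `m(s) = ⟨v₂(s)⟩`, `m'(s) = ⟨∂ₜv₂(s)⟩` on the plane `{x₂ = ζ}` (centre 0, height ζ)
  have hcz : (0 : EuclideanSpace ℝ (Fin 3)) 2 + ζ = ζ := by simp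
  have hmean_sq : ∀ s ≤ t, hmean φ 0 R ζ (fun x => ‖v s x‖ ^ 2) ≤ δ ^ 2 := fun s hs => hR₀ R hRR₀ s hs 0 ζ
  have hm_le : ∀ s ∈ Icc t' t, |hmean φ 0 R ζ (fun x => v s x 2)| ≤ δ := fun s hs =>
    abs_hmean_apply_le_of_sq φ 0 R ζ ((contDiff_slice hrate hcont hmild (hIcc0 hs)).continuous) 2 hδ0.le
      (hmean_sq s hs.2)
  -- per-slice plane law estimate
  obtain ⟨Θ, hΘ⟩ : ∃ T : ℝ, T = Bμ * (3 * M₁ * δ + 2 * (R⁻¹ * M₁ * Bφ)) + (Bμ + Bμ) * δ + Bμ / 2 * δ ^ 2 +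
      2 * Bμ * (R⁻¹ * M₀ * Bφ) := ⟨_, rfl⟩
  have hslice : ∀ s ∈ Icc t' t,
      |A s ζ - (1 - μ s ζ) * hmean φ 0 R ζ (fun x => deriv (fun σ => v σ x 2) s)| ≤ Θ := by
    intro s hs
    have hs0 : s < 0 := hIcc0 hs
    have hsI : s ∈ Ioo t₁ t₂ := hIcc hs
    have hw : ContDiff ℝ 2 (v s) := (contDiff_slice hrate hcont hmild hs0).of_le (by norm_cast)
    have hplane : ∀ x : EuclideanSpace ℝ (Fin 3), x 2 = ζ →
        (1 - μ s ζ) * (deriv (fun σ => v σ x 2) s + fderiv ℝ (fun y => v s y 2) x (v s x) - Δ (fun y => v s y 2) x) =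
          A s ζ + (deriv (fun σ => μ σ ζ) s - deriv (deriv (μ s)) ζ) * v s x 2 + deriv (μ s) ζ / 2 * v s x 2 ^ 2 -
            2 * deriv (μ s) ζ * fderiv ℝ (v s) x (EuclideanSpace.single 2 1) 2 := by
      intro x hx
      have hp : ((s, x) : ℝ × EuclideanSpace ℝ (Fin 3)) ∈ Ioo t₁ t₂ ×ˢ {x : EuclideanSpace ℝ (Fin 3) | z₁ < x 2 ∧ x 2 < z₂} :=
        mk_mem_prod hsI (by rw [mem_setOf_eq, hx]; exact hζ)
      have h := hE _ hp
      dsimp only at h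
      rw [hx] at h
      exact h
    have h := abs_pressureDatum_sub_le φ 0 R ζ hw (hvM s hs.2) (hDvM s hs.2) (div_coord (hdiv s hs0))
      (continuous_timeDeriv_two_slice hsm hs0) hplane hRpos hcz hδ0.le (hmean_sq s hs.2)
    rw [← hBφ] at h
    refine h.trans ?_
    have hRi : 0 ≤ R⁻¹ := inv_nonneg.2 hRpos.le
    have e1 := hb1 s hs; have e2 := hb2 s hs; have e3 := hb3 s hs; have e4 := hb4 s hs
    have hx1 : 0 ≤ 3 * M₁ * δ + 2 * (R⁻¹ * M₁ * Bφ) := by positivity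
    have hx2 : 0 ≤ R⁻¹ * M₀ * Bφ := by positivity
    have f1 := mul_le_mul_of_nonneg_right e1 hx1
    have f2 := mul_le_mul_of_nonneg_right (add_le_add e2 e4) hδ0.le
    have f3 := mul_le_mul_of_nonneg_right (div_le_div_of_nonneg_right e3 zero_le_two) (sq_nonneg δ)
    have f4 := mul_le_mul_of_nonneg_right (mul_le_mul_of_nonneg_left e3 zero_le_two) hx2
    rw [hΘ]
    linarith
  -- continuity in time of the two means and of the integrands
  have hm'c : ContinuousOn (fun s => hmean φ 0 R ζ (fun x => deriv (fun σ => v σ x 2) s)) (Icc t' t) :=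
    (continuousOn_hmean_param φ 0 R ζ isOpen_Iio (G := fun σ x => deriv (fun s => v s x 2) σ)
      (continuousOn_timeDeriv_two hsm)).mono hIcc0
  have hmc : ContinuousOn (fun s => hmean φ 0 R ζ (fun x => v s x 2)) (Icc t' t) := by
    have hG : ContinuousOn (uncurry fun σ (x : EuclideanSpace ℝ (Fin 3)) => v σ x 2) (Iio (0 : ℝ) ×ˢ univ) :=
      (EuclideanSpace.proj (2 : Fin 3)).continuous.comp_continuousOn hsm.continuousOn
    exact (continuousOn_hmean_param φ 0 R ζ isOpen_Iio hG).mono hIcc0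
  have hAc : ContinuousOn (fun s => A s ζ) (Icc t' t) := hfac.mono hIcc
  have huc : ContinuousOn (fun s => 1 - μ s ζ) (Icc t' t) := (continuousOn_const.sub hf0c).mono hIcc
  have hu'c : ContinuousOn (fun s => -deriv (fun σ => μ σ ζ) s) (Icc t' t) := (hftc.mono hIcc).neg
  have huIcc : uIcc t' t = Icc t' t := uIcc_of_le ht't
  -- integration by parts for `∫ (1 − μ)⟨∂ₜv₂⟩`
  have hparts := intervalIntegral.integral_mul_deriv_eq_deriv_mul (a := t') (b := t)
    (u := fun s => 1 - μ s ζ) (u' := fun s => -deriv (fun σ => μ σ ζ) s)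
    (v := fun s => hmean φ 0 R ζ (fun x => v s x 2)) (v' := fun s => hmean φ 0 R ζ (fun x => deriv (fun σ => v σ x 2) s))
    (fun s hs => by
      rw [huIcc] at hs
      exact (hasDerivAt_boxCoeff_time hμ hζ (hIcc hs)).const_sub 1)
    (fun s hs => by
      rw [huIcc] at hs
      exact hasDerivAt_hmean_two hsm φ 0 R ζ (hIcc0 hs))
    (hu'c.mono (by rw [huIcc])).intervalIntegrable (hm'c.mono (by rw [huIcc])).intervalIntegrable
  -- the two integrals
  have hi1 : IntervalIntegrable (fun s => A s ζ) volume t' t := (hAc.mono (by rw [huIcc])).intervalIntegrable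
  have hi2 : IntervalIntegrable (fun s => (1 - μ s ζ) * hmean φ 0 R ζ (fun x => deriv (fun σ => v σ x 2) s)) volume t' t :=
    ((huc.mul hm'c).mono (by rw [huIcc])).intervalIntegrable
  have hsplit : ∫ s in t'..t, A s ζ = (∫ s in t'..t, (A s ζ - (1 - μ s ζ) * hmean φ 0 R ζ (fun x => deriv (fun σ => v σ x 2) s))) +
      ∫ s in t'..t, (1 - μ s ζ) * hmean φ 0 R ζ (fun x => deriv (fun σ => v σ x 2) s) := by
    rw [intervalIntegral.integral_sub hi1 hi2]; ring
  -- bound the first integral by `Θ L`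
  have hI1 : |∫ s in t'..t, (A s ζ - (1 - μ s ζ) * hmean φ 0 R ζ (fun x => deriv (fun σ => v σ x 2) s))| ≤ Θ * L := by
    have h := intervalIntegral.norm_integral_le_of_norm_le_const (a := t') (b := t) (C := Θ)
      (f := fun s => A s ζ - (1 - μ s ζ) * hmean φ 0 R ζ (fun x => deriv (fun σ => v σ x 2) s)) fun s hs => by
        rw [uIoc_of_le ht't] at hs
        rw [Real.norm_eq_abs]
        exact hslice s ⟨hs.1.le, hs.2⟩
    rw [Real.norm_eq_abs, abs_of_nonneg (by linarith : (0 : ℝ) ≤ t - t')] at h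
    simpa [hL] using h
  -- bound the boundary and the remaining integral by `Bμ δ`
  have htmem : t ∈ Icc t' t := ⟨ht't, le_rfl⟩
  have hbd : ∀ s ∈ Icc t' t, |(1 - μ s ζ) * hmean φ 0 R ζ (fun x => v s x 2)| ≤ Bμ * δ := fun s hs => by
    rw [abs_mul]; exact mul_le_mul (hb1 s hs) (hm_le s hs) (abs_nonneg _) hBμ0
  have hI3 : |∫ s in t'..t, -deriv (fun σ => μ σ ζ) s * hmean φ 0 R ζ (fun x => v s x 2)| ≤ Bμ * δ * L := by
    have h := intervalIntegral.norm_integral_le_of_norm_le_const (a := t') (b := t) (C := Bμ * δ)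
      (f := fun s => -deriv (fun σ => μ σ ζ) s * hmean φ 0 R ζ (fun x => v s x 2)) fun s hs => by
        rw [uIoc_of_le ht't] at hs
        rw [Real.norm_eq_abs, abs_mul, abs_neg]
        exact mul_le_mul (hb2 s ⟨hs.1.le, hs.2⟩) (hm_le s ⟨hs.1.le, hs.2⟩) (abs_nonneg _) hBμ0
    rw [Real.norm_eq_abs, abs_of_nonneg (by linarith : (0 : ℝ) ≤ t - t')] at h
    simpa [hL] using h
  have hI2 : |∫ s in t'..t, (1 - μ s ζ) * hmean φ 0 R ζ (fun x => deriv (fun σ => v σ x 2) s)| ≤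
      Bμ * δ + Bμ * δ + Bμ * δ * L := by
    rw [hparts]
    have e1 := hbd t htmem; have e2 := hbd t' ht'mem
    calc _ ≤ |(1 - μ t ζ) * hmean φ 0 R ζ (fun x => v t x 2) - (1 - μ t' ζ) * hmean φ 0 R ζ (fun x => v t' x 2)| +
          |∫ s in t'..t, -deriv (fun σ => μ σ ζ) s * hmean φ 0 R ζ (fun x => v s x 2)| := abs_sub _ _
      _ ≤ (|(1 - μ t ζ) * hmean φ 0 R ζ (fun x => v t x 2)| + |(1 - μ t' ζ) * hmean φ 0 R ζ (fun x => v t' x 2)|) +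
          Bμ * δ * L := add_le_add (abs_sub _ _) hI3
      _ ≤ _ := by linarith only [e1, e2]
  -- assemble: `|∫ A| ≤ Θ L + 2 Bμ δ + Bμ δ L ≤ δ P + R⁻¹ Q ≤ η`
  have hδsq : δ ^ 2 ≤ δ := by rw [sq]; exact mul_le_of_le_one_right hδ0.le hδ1
  have hRi : 0 ≤ R⁻¹ := inv_nonneg.2 hRpos.le
  have hkey : Θ * L + (Bμ * δ + Bμ * δ + Bμ * δ * L) ≤ δ * P + R⁻¹ * Q := by
    have h1 : L * (Bμ / 2 * δ ^ 2) ≤ L * (Bμ / 2 * δ) :=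
      mul_le_mul_of_nonneg_left (mul_le_mul_of_nonneg_left hδsq (by positivity)) hL0
    have e : δ * P + R⁻¹ * Q = L * (Bμ * (3 * M₁ * δ + 2 * (R⁻¹ * M₁ * Bφ)) + (Bμ + Bμ) * δ + Bμ / 2 * δ +
        2 * Bμ * (R⁻¹ * M₀ * Bφ)) + (Bμ * δ + Bμ * δ + Bμ * δ * L) := by rw [hP, hQ]; ring
    rw [e, hΘ]
    linarith only [h1]
  calc |∫ s in t'..t, A s ζ|
      = |(∫ s in t'..t, (A s ζ - (1 - μ s ζ) * hmean φ 0 R ζ (fun x => deriv (fun σ => v σ x 2) s))) +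
          ∫ s in t'..t, (1 - μ s ζ) * hmean φ 0 R ζ (fun x => deriv (fun σ => v σ x 2) s)| := by rw [← hsplit]
    _ ≤ Θ * L + (Bμ * δ + Bμ * δ + Bμ * δ * L) := (abs_add_le _ _).trans (add_le_add hI1 hI2)
    _ ≤ δ * P + R⁻¹ * Q := hkey
    _ ≤ η := by linarith only [hδP, hRQ]

/-- **Sparse energy ⇒ the (TH) pressure datum vanishes.**  See the module docstring. [folklore] -/
theorem pressureDatum_eq_zero (hrate : HasTypeITimeDecay C v)
    (hcont : ContinuousOn (uncurry v) (Iio (0 : ℝ) ×ˢ univ))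
    (hmild : ∀ s t : ℝ, s < t → t < 0 → ∀ x,
      v t x = UnboundedOperators.heatExtension (v s) (t - s) x - oseenDuhamel 1 s v v t x)
    (hdiv : ∀ t < 0, VectorCalculus.IsDivFree (v t))
    {K : ℝ} (hK0 : 0 ≤ K)
    (hK : ∀ t₀ : ℝ, t₀ < 0 → ∀ (a : EuclideanSpace ℝ (Fin 3)) (R : ℝ), 0 < R →
      (∫⁻ x in Metric.ball a R, ENNReal.ofReal (‖v t₀ x‖ ^ 2)) ≤ ENNReal.ofReal (K * R))
    {μ A : ℝ → ℝ → ℝ} {t₁ t₂ z₁ z₂ : ℝ} (ht₂ : t₂ ≤ 0)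
    (hμ : ∀ q ∈ Ioo t₁ t₂ ×ˢ Ioo z₁ z₂, AnalyticAt ℝ (uncurry μ) q)
    (hA : ∀ q ∈ Ioo t₁ t₂ ×ˢ Ioo z₁ z₂, AnalyticAt ℝ (uncurry A) q)
    (hE : ∀ p ∈ Ioo t₁ t₂ ×ˢ {x : EuclideanSpace ℝ (Fin 3) | z₁ < x 2 ∧ x 2 < z₂},
      (1 - μ p.1 (p.2 2)) *
          (deriv (fun s => v s p.2 2) p.1 + fderiv ℝ (fun y => v p.1 y 2) p.2 (v p.1 p.2) - Δ (fun y => v p.1 y 2) p.2) =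
        A p.1 (p.2 2) + (deriv (fun s => μ s (p.2 2)) p.1 - deriv (deriv (μ p.1)) (p.2 2)) * v p.1 p.2 2
          + deriv (μ p.1) (p.2 2) / 2 * v p.1 p.2 2 ^ 2 - 2 * deriv (μ p.1) (p.2 2) * fderiv ℝ (v p.1) p.2 (EuclideanSpace.single 2 1) 2) :
    ∀ q ∈ Ioo t₁ t₂ ×ˢ Ioo z₁ z₂, A q.1 q.2 = 0 := by
  rintro ⟨τ, ζ⟩ hq
  obtain ⟨hτ, hζ⟩ := mem_prod.1 hq
  dsimp only at hτ hζ ⊢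
  -- the pressure datum along the height `ζ` is continuous in time
  obtain ⟨hfac, -, -, -⟩ := continuousOn_boxCoeffs hA hζ
  -- MAIN CLAIM: the time integrals of `A(·,ζ)` vanish
  have hclaim : ∀ t' t : ℝ, t₁ < t' → t' ≤ t → t < t₂ → ∫ s in t'..t, A s ζ = 0 := fun t' t h1 h2 h3 =>
    integral_pressureDatum_eq_zero hrate hcont hmild hdiv hK0 hK ht₂ hμ hA hE hζ h1 h2 h3
  -- FTC: `A(τ,ζ)` is the derivative of the vanishing integral function
  obtain ⟨t', ht'⟩ : ∃ r : ℝ, r = (t₁ + τ) / 2 := ⟨_, rfl⟩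
  have ht₁' : t₁ < t' := by rw [ht']; linarith [hτ.1]
  have ht'τ : t' < τ := by rw [ht']; linarith [hτ.1]
  have hAcont : ContinuousAt (fun s => A s ζ) τ := hfac.continuousAt (Ioo_mem_nhds hτ.1 hτ.2)
  have hii : IntervalIntegrable (fun s => A s ζ) volume t' τ := by
    refine (hfac.mono ?_).intervalIntegrable
    rw [uIcc_of_le ht'τ.le]
    exact fun s hs => ⟨lt_of_lt_of_le ht₁' hs.1, lt_of_le_of_lt hs.2 hτ.2⟩
  have hderiv := intervalIntegral.integral_hasDerivAt_right hii
    (hfac.stronglyMeasurableAtFilter isOpen_Ioo τ hτ) hAcont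
  have hev : (fun _ : ℝ => (0 : ℝ)) =ᶠ[𝓝 τ] fun u => ∫ s in t'..u, A s ζ := by
    filter_upwards [Ioo_mem_nhds ht'τ hτ.2] with u hu
    exact (hclaim t' u ht₁' hu.1.le hu.2).symm
  have h0 : HasDerivAt (fun _ : ℝ => (0 : ℝ)) (A τ ζ) τ := hderiv.congr_of_eventuallyEq hev
  exact ((hasDerivAt_const τ (0 : ℝ)).unique h0).symm

end Summit.NavierStokesRegularity.NavierStokesRegularity.Theorems.PoloidalWindowDoorPoloidalWindowRigiditySparseEnergySourceFree

end
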